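import Literature.MathematicalPhysics.QuantumFieldTheory.Balaban1983to89.B9Thm313WholeHolderZ
import Literature.MathematicalPhysics.QuantumFieldTheory.Balaban1983to89.B9Thm313WholeRgdFrom3152

/-!
# `Balaban1983to89.B9Thm313WholeProbe43RHolderCut` — [B9] Theorem 3.13 (p. 426), THE RIGHT (3.43) MEMBER Φ^X_β∘𝔊∘∇*_U OF 𝔊 WITHOUT THE
# LETTER `Letters313Z.rgd1`: term B of (3.153) re-cut by G₁DR = DG′R ((3.152)) at a free class of G₁∇*_U — the probe twin of
# `B9Thm313WholeEntry2HolderCut` (the fourth and last reader of `rgd1`, located by ym-inputs-p03 g2)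

T. Bałaban, *Propagators for lattice gauge theories in a background field*, Commun. Math. Phys. **99** (1985) 389–434
[`Balaban1985BackgroundPropagators`, "B9"]; [4] = T. Bałaban, *Propagators and renormalization transformations for lattice gauge
theories. II*, Commun. Math. Phys. **96** (1984) 223–250 [`Balaban1984PropagatorsII`].

statement-level skeleton of published theorems with citation tags; proofs where landed; nothing here is a claim about the Yang–Mills mass gap

THE PRINTED LOCUS (held text `paper:balaban1985-cmp99-background-propagators`).  (3.43) p. 398 (‖ζG∇\*_Uλ‖_β ≦ B₀(β)(Lʲη)^{1−β}e^{−δ₀d}|λ|); (3.44)∕(3.45)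
p. 398 (the mixed second-order members carry a HÖLDER norm of the input; B′₀(ε), B′₀(ε,β) → ∞ as ε → 0); (3.152) p. 426 *"RD\*G₁ = RG′D\*, and G₁DR = DG′R"*;
(3.153) p. 426; Theorem 3.13 p. 426 (Theorem 3.3 — incl. (3.43) — for 𝔊).

THE POINT (cell `pub/ym-inputs` seat p04; LOCATE memo `LETTERS-313-LOCATE-p04.md` §2 (L1); ym-inputs-p03 g2 10:09Z: «READERS of `rgd1` = FOUR — … and
`GG_probe43R_of_lettersZ` (`B9Thm313WholeHolderZ` :309), term B = (E·G₁D)∘(R·D\*·G₁·∇\*)»).  As in `GG_entry2_of_lettersZ`, the probe face cuts term B of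
Φ^X_β∘𝔊∘∇\*_U at the PURE sup class W⁰ of R·D\*·G₁·∇\*_U — the (3.44) species without its Hölder term, no member-uniform supplier at genuine operators.  By
(3.152), E·G₁·D·R·D\*·G₁·∇\*_U = E·(G₁DR)·(D\*G₁∇\*_U) = (E∘D∘G′∘R∘D\*) ∘ (G₁∇\*_U): cut at a FREE class `bXH` of G₁∇\*_U (print's (3.42)₃ ⊕ (3.43) species for G₁) with
a probe-valued letter for the order-zero site word, Φ^X_β∘(D·G′·R·D\*) : `bXH` → 𝔠_P^{(β−1)} ((3.45) species for G′ with (3.49) for R).  THIS FILE: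
* §1 `E_GG_F_eq_3152` — (3.153) with a left and a right factor, term B rewritten by `Ids3152.dr` (pure algebra);
* §2 ★★ `GG_probe43R_holderCut_of_letters` — the statement shape of `B9Thm313WholeHolderZ.GG_probe43R_of_lettersZ` (two-space probe majorant
  C·(Lʲη)^{1−β}·e^{−ρ′d} of Φ^X_β∘(𝔊∘∇\*_U) from `blkY` into `blkPX`) from `he2`, `h43`, `hK`, `hpX`, `hpQs`, the `Letters313Z` fields `gQs1 ∕ c1_1 ∕ q1` VERBATIM,
  `Identities`, `Ids3152`, and — in place of `rgd1` (and of `gD1`, `hpDv`, no longer read) — `hXH : HasMaj (cNorm … blkY 0) bXH (G₁∘∇\*_U) (B_X·e^{−δ₃d})` and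
  `hWE : HasMaj bXH (cNormR … blkPX (β−1)) (Φ^X_β ∘ (D∘G′∘R∘D\*)) (B_WE·e^{−δ₃d})`; constant
  C = (Bh + θ_H·A₁·c) + κ_{XH}·B_WE·B_X·c + (Bx + θ_H·A₃·c)·(B₃·(B₃·A₁·c)·c)·c, A₁ = B₀(1−θc)⁻¹, A₃ = B₃(1−θc)⁻¹.

HONEST SCOPE.  Kernel bookkeeping over landed schemas; the displayed letter `rgd1` is REPLACED by two hypotheses of printed species, not discharged; nothing of
[B9]'s estimates asserted; COUNT-NEUTRAL; N06 NOT discharged; adoption by the certificate ∕ the T³ rows is their owners' call (dag-n06-d ∕ dag-n06-l; ★★OWNER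
ym3-torus-plan).  One finite lattice at a time; nothing continuum, nothing about the mass gap ∕ Clay.  Seat `ym-inputs-p04` (prover-ym-inputs-p04-0), 2026-08-28; NEW file.
-/

namespace Literature.MathematicalPhysics.QuantumFieldTheory.Balaban1983to89.B9Thm313WholeProbe43RHolderCut

open Literature.MathematicalPhysics.QuantumFieldTheory.Balaban1983to89
open Finset B6RandomWalk B6RandomWalkHom B9Thm34Ext B9Thm37GlueCor36 B11SectG B9SectDSup
open B9Thm37AllNorms B9Thm37AllNormsInstances B9Thm312Whole B9Thm312WholeLeaf B9Thm312WholeLeft B9Thm313Whole B9Thm313WholeLeft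
open B9RWSums343Holder B9Ineq347 B9Thm312WholeClasses B9Thm312WholeHolder B9Thm312WholeHHolder B9Thm313WholeHolder
open B9Thm313WholeZ B9Thm313WholeLeftZ B9Thm313WholeHolderZ B9Thm313WholeRgdFrom3152

noncomputable section

section OneMember

variable {g : B9.Geometry} {B : B9.Backgrounds} {X Y Z W PX PY : Type}
variable [Fintype X] [Fintype Y] [Fintype Z] [Fintype W] [Fintype PX] [Fintype PY] [Fintype g.Site]
variable {R₀ : ℝ} {H₀ : Prop}

/-! ## §1 (3.153) with a left and a right factor, term B through (3.152) -/

omit [Fintype Y] [Fintype PX] [Fintype PY] [Fintype g.Site] in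
/-- **(3.153) WITH A LEFT FACTOR E AND A RIGHT FACTOR F, TERM B BY (3.152)**: E𝔊F = EG₁F − (E·D·G′·R·D\*)(G₁F) − (EG₁Q\*)((QG₁Q\*)⁻¹(Q(G₁F)))
(`B9Thm313WholeHolder.E_GG_F_eq` with (EG₁D)(RD\*G₁F) = E(G₁DR)(D\*G₁F) = E(DG′R)(D\*G₁F), `Ids3152.dr`). [cite: Balaban1985BackgroundPropagators, (3.152)–(3.153) p.426] -/
theorem E_GG_F_eq_3152 {V' V'' : Type} {𝔬 : Ops g B X Y Z W} {Gp : B.Cfg → Module.End ℝ (W → ℝ)} {U : B.Cfg} (hI : Identities 𝔬 U)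
    (h152 : Ids3152 𝔬 Gp U) (E : (X → ℝ) →ₗ[ℝ] (V' → ℝ)) (F : (V'' → ℝ) →ₗ[ℝ] (X → ℝ)) :
    E ∘ₗ (𝔬.GG U ∘ₗ F) =
      E ∘ₗ 𝔬.G1 U ∘ₗ F -
        (E ∘ₗ (𝔬.Dv U ∘ₗ Gp U ∘ₗ 𝔬.R U ∘ₗ 𝔬.Dvstar U)) ∘ₗ (𝔬.G1 U ∘ₗ F) -
        (E ∘ₗ 𝔬.G1 U ∘ₗ 𝔬.Qstar U) ∘ₗ (𝔬.C1 U ∘ₗ (𝔬.Q U ∘ₗ (𝔬.G1 U ∘ₗ F))) := by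
  have hmid : (E ∘ₗ 𝔬.G1 U ∘ₗ 𝔬.Dv U) ∘ₗ (𝔬.R U ∘ₗ 𝔬.Dvstar U ∘ₗ 𝔬.G1 U ∘ₗ F) =
      (E ∘ₗ (𝔬.Dv U ∘ₗ Gp U ∘ₗ 𝔬.R U ∘ₗ 𝔬.Dvstar U)) ∘ₗ (𝔬.G1 U ∘ₗ F) := by
    refine LinearMap.ext fun v => ?_
    simp only [LinearMap.comp_apply]
    rw [h152.dr_apply]
  rw [E_GG_F_eq hI E F, hmid]

/-! ## §2 One member, one U: the right (3.43) member of 𝔊 with term B cut at a free class of G₁∇*_U -/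

omit [Fintype PY] in
/-- ★★ **THEOREM 3.13, THE RIGHT (3.43) MEMBER Φ^X_β∘𝔊∘∇\*_U — TERM B CUT AT A FREE CLASS OF G₁∇\*_U, NO LETTER `rgd1`** (statement shape of
`B9Thm313WholeHolderZ.GG_probe43R_of_lettersZ`): from Theorem 3.3's (3.42)₃ (`he2`) and the probe of (3.43)₂ (`h43`) for G₀, the step K′₁ on 𝔠⁽¹⁾ (`hK`, θc < 1) and its
probe (`hpX`, θ_He^{−δ_Kd}), the `Letters313Z` fields `gQs1 ∕ c1_1 ∕ q1`, the probe letter `hpQs` (Φ^X_βG₀Q\* from Z_{len·wZ}, `Letters313HZ.pXQs`), `Identities`,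
the identity G₁DR = DG′R (`Ids3152`) and — IN PLACE OF `rgd1` — `hXH` (G₁∇\*_U : Y⁰ → `bXH`, B_X·e^{−δ₃d}; (3.42)₃ ⊕ (3.43) species for G₁) and `hWE`
(Φ^X_β∘(D∘G′∘R∘D\*) : `bXH` → 𝔠_P^{(β−1)}, B_WE·e^{−δ₃d}; (3.45) species for G′ with (3.49)): Φ^X_β∘𝔊∘∇\*_U has majorant C·e^{−ρ′d} from 𝔠_Y^{(0)} into 𝔠_P^{(β−1)},
whence the two-space shape C·(Lʲη)^{1−β}e^{−ρ′d}, C = (Bh + θ_HA₁c) + κ_{XH}B_WEB_Xc + (Bx + θ_HA₃c)(B₃(B₃A₁c)c)c (A₁ = B₀(1−θc)⁻¹, A₃ = B₃(1−θc)⁻¹), for every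
ρ′ ≧ 0 with ρ′ + 3σ ≦ ρ (ρ ≦ δ₀, ρ ≦ δ₃, ρ + σ ≦ δ_K).
[cite: Balaban1985BackgroundPropagators, Thm 3.13 p.426 + (3.152)–(3.153) p.426 + (3.138) p.423 + (3.43)–(3.45) p.398; Balaban1984PropagatorsII, (2.52)–(2.56) pp.232–233 + Lemma 2.1 (2.61) p.234] -/
theorem GG_probe43R_holderCut_of_letters (hG : GeoOK g) {𝔬 : Ops g B X Y Z W} (𝔭 : HolderProbes g B X Y PX PY) {U : B.Cfg}
    {Gp : B.Cfg → Module.End ℝ (W → ℝ)} {bXH : BlockNorm (toB6 g R₀ H₀) (X → ℝ)}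
    {θ θH B₀ B₃ Bh Bx BX BWE β δ₀ δ₃ δK ρ ρ' σ c : ℝ} (hrow : RowSum (toB6 g R₀ H₀) σ c) (hc : 0 ≤ c)
    (hθ : 0 ≤ θ) (hθH : 0 ≤ θH) (hB₀ : 0 ≤ B₀) (hB₃ : 0 ≤ B₃) (hBh : 0 ≤ Bh) (hBx : 0 ≤ Bx) (hBX : 0 ≤ BX) (hBWE : 0 ≤ BWE)
    (hσ : 0 ≤ σ) (hρ' : 0 ≤ ρ') (hρ'ρ : ρ' + 3 * σ ≤ ρ) (hρS : ρ ≤ δ₀) (hρ₃ : ρ ≤ δ₃) (hρδ : ρ + σ ≤ δK) (hq : θ * c < 1)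
    (hK : HasMaj (cNorm R₀ H₀ 𝔬.blk hG.lenle 1) (cNorm R₀ H₀ 𝔬.blk hG.lenle 1) (𝔬.G0 U ∘ₗ (𝔬.Tpi U + 𝔬.T2 U))
      (fun a b => θ * Real.exp (-(δK * g.dist a b))))
    (he2 : HasMajorantHom (g := toB6 g R₀ H₀) 𝔬.blkY 𝔬.blk (𝔬.G0 U ∘ₗ 𝔬.Dstar U)
      (fun a b => B₀ * g.len a * Real.exp (-(δ₀ * g.dist a b))))
    (h43 : HasMajorantHom (g := toB6 g R₀ H₀) 𝔬.blkY 𝔭.blkPX (𝔭.ΦX U β ∘ₗ (𝔬.G0 U ∘ₗ 𝔬.Dstar U))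
      (fun (a b : g.Site) => Bh * g.len a ^ (1 - β) * Real.exp (-(δ₀ * g.dist a b))))
    (hpX : HasMaj (cNormR R₀ H₀ 𝔬.blk hG.lenle (-1)) (cNormR R₀ H₀ 𝔭.blkPX hG.lenle (β - 1))
      ((𝔭.ΦX U β ∘ₗ 𝔬.G0 U) ∘ₗ (𝔬.Tpi U + 𝔬.T2 U)) (fun a b => θH * Real.exp (-(δK * g.dist a b))))
    {wZ : g.Site → ℝ} {hwZ : ∀ y, 0 < wZ y}
    (hpQs : HasMaj (weightNorm (BlockNorm.ofBlocks (toB6 g R₀ H₀) 𝔬.blkZ) (fun y => g.len y * wZ y) fun y => (wZlen_pos hG hwZ y).le)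
      (cNormR R₀ H₀ 𝔭.blkPX hG.lenle (β - 1)) ((𝔭.ΦX U β ∘ₗ 𝔬.G0 U) ∘ₗ 𝔬.Qstar U) (fun a b => Bx * Real.exp (-(δ₃ * g.dist a b))))
    (hgQs1 : HasMaj (weightNorm (BlockNorm.ofBlocks (toB6 g R₀ H₀) 𝔬.blkZ) (fun y => g.len y * wZ y) fun y => (wZlen_pos hG hwZ y).le)
      (cNorm R₀ H₀ 𝔬.blk hG.lenle 1) (𝔬.G0 U ∘ₗ 𝔬.Qstar U) (fun a b => B₃ * Real.exp (-(δ₃ * g.dist a b))))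
    (hc1_1 : HasMaj (cNorm R₀ H₀ 𝔬.blkZ hG.lenle 1)
      (weightNorm (BlockNorm.ofBlocks (toB6 g R₀ H₀) 𝔬.blkZ) (fun y => g.len y * wZ y) fun y => (wZlen_pos hG hwZ y).le) (𝔬.C1 U)
      (fun a b => B₃ * Real.exp (-(δ₃ * g.dist a b))))
    (hq1 : HasMaj (cNorm R₀ H₀ 𝔬.blk hG.lenle 1) (cNorm R₀ H₀ 𝔬.blkZ hG.lenle 1) (𝔬.Q U)
      (fun a b => B₃ * Real.exp (-(δ₃ * g.dist a b))))
    (hXH : HasMaj (cNorm R₀ H₀ 𝔬.blkY hG.lenle 0) bXH (𝔬.G1 U ∘ₗ 𝔬.Dstar U)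
      (fun a b => BX * Real.exp (-(δ₃ * g.dist a b))))
    (hWE : HasMaj bXH (cNormR R₀ H₀ 𝔭.blkPX hG.lenle (β - 1)) (𝔭.ΦX U β ∘ₗ (𝔬.Dv U ∘ₗ Gp U ∘ₗ 𝔬.R U ∘ₗ 𝔬.Dvstar U))
      (fun a b => BWE * Real.exp (-(δ₃ * g.dist a b))))
    (hI : Identities 𝔬 U) (h152 : Ids3152 𝔬 Gp U) :
    HasMajorantHom (g := toB6 g R₀ H₀) 𝔬.blkY 𝔭.blkPX (𝔭.ΦX U β ∘ₗ (𝔬.GG U ∘ₗ 𝔬.Dstar U))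
      (fun (a b : g.Site) => ((Bh + θH * (B₀ * (1 - θ * c)⁻¹) * c) + bXH.κ * BWE * BX * c +
          (Bx + θH * (B₃ * (1 - θ * c)⁻¹) * c) * (B₃ * (B₃ * (B₀ * (1 - θ * c)⁻¹) * c) * c) * c) *
        g.len a ^ (1 - β) * Real.exp (-(ρ' * g.dist a b))) := by
  -- adapted from `B9Thm313WholeHolderZ.GG_probe43R_of_lettersZ` (term B through `bXH` by (3.152) instead of through W⁰ by `rgd1`)
  have hinv : 0 ≤ (1 - θ * c)⁻¹ := inv_nonneg.mpr (by linarith)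
  have hA₁ : 0 ≤ B₀ * (1 - θ * c)⁻¹ := mul_nonneg hB₀ hinv
  have hA₃ : 0 ≤ B₃ * (1 - θ * c)⁻¹ := mul_nonneg hB₃ hinv
  have hCL : 0 ≤ Bh + θH * (B₀ * (1 - θ * c)⁻¹) * c := add_nonneg hBh (mul_nonneg (mul_nonneg hθH hA₁) hc)
  have hfix1 := fix_of_inverses hI.invG0' hI.invG1
  have hρ0 : 0 ≤ ρ := by linarith
  have htri : Triangle254 (toB6 g R₀ H₀) := fun a b c => hG.tri a b c
  set E : (X → ℝ) →ₗ[ℝ] (PX → ℝ) := 𝔭.ΦX U β with hE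
  set bout := cNormR R₀ H₀ 𝔭.blkPX hG.lenle (β - 1) with hbout
  -- (a) the right entries of G₁ in the real classes: G₁∇* : Y^{(0)} → 𝔠^{(−1)}, G₁Q* : Z_{len·wZ} → 𝔠^{(−1)}
  have hG1 : HasMaj (cNormR R₀ H₀ 𝔬.blkY hG.lenle 0) (cNormR R₀ H₀ 𝔬.blk hG.lenle (-1)) (𝔬.G1 U ∘ₗ 𝔬.Dstar U)
      (fun a b => B₀ * (1 - θ * c)⁻¹ * Real.exp (-(ρ * g.dist a b))) := by
    have h := hasMaj_toR hG (hasMaj_entry2_cNorm hG hrow hθ hB₀ hρ0 hρS hρδ hK he2 hfix1 hq)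
    simp only [Nat.cast_zero, neg_zero, Nat.cast_one] at h
    exact h
  have hGQ : HasMaj (weightNorm (BlockNorm.ofBlocks (toB6 g R₀ H₀) 𝔬.blkZ) (fun y => g.len y * wZ y) fun y => (wZlen_pos hG hwZ y).le)
      (cNormR R₀ H₀ 𝔬.blk hG.lenle (-1)) (𝔬.G1 U ∘ₗ 𝔬.Qstar U) (fun a b => B₃ * (1 - θ * c)⁻¹ * Real.exp (-(ρ * g.dist a b))) := by
    have h := hasMaj_toR_tgt hG (hasMaj_right_of_step_weight hG (wZlen_pos hG hwZ) hrow hθ hB₃ hρ0 hρ₃ hρδ hK hgQs1 hfix1 hq)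
    simp only [Nat.cast_one] at h
    exact h
  -- (b) the head E G₀∇* : Y^{(0)} → 𝔠_P^{(β−1)} from (3.43)₂ for G₀, and E G₁∇*
  have hE0 : HasMaj (cNormR R₀ H₀ 𝔬.blkY hG.lenle 0) bout (E ∘ₗ 𝔬.G0 U ∘ₗ 𝔬.Dstar U) (fun a b => Bh * Real.exp (-(δ₀ * g.dist a b))) := by
    have h := hasMaj_cNormR_of_hasMajorantHom hG (C := fun a b => Bh * Real.exp (-(δ₀ * g.dist a b)))
      (fun a b => mul_nonneg hBh (Real.exp_nonneg _)) (1 - β) 0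
      (hasMajorantHom_mono (g := toB6 g R₀ H₀) 𝔬.blkY 𝔭.blkPX h43 fun a b => le_of_eq (by simp only [Real.rpow_zero, mul_one]; ring))
    have e : -(1 - β) = β - 1 := by ring
    rw [e] at h
    exact h
  have hKE : HasMaj (cNormR R₀ H₀ 𝔬.blk hG.lenle (-1)) bout (E ∘ₗ 𝔬.G0 U ∘ₗ (𝔬.Tpi U + 𝔬.T2 U))
      (fun a b => θH * Real.exp (-(δK * g.dist a b))) := hpX
  have hD1 : HasMaj (cNormR R₀ H₀ 𝔬.blkY hG.lenle 0) bout (E ∘ₗ 𝔬.G1 U ∘ₗ 𝔬.Dstar U)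
      (fun y y' => (Bh + θH * (B₀ * (1 - θ * c)⁻¹) * c) * Real.exp (-(ρ * g.dist y y'))) :=
    hasMaj_left_rightR hG hrow hθH hBh hA₁ hρ0 hρS le_rfl hρδ hKE hE0 hG1 hfix1
  -- (c) TERM B = (E·D·G′·R·D*)∘(G₁∇*) through the free class `bXH` ((3.152), no letter `rgd1`)
  have hρ'₃ : ρ' ≤ δ₃ := by linarith
  have hXH' : HasMaj (cNormR R₀ H₀ 𝔬.blkY hG.lenle 0) bXH (𝔬.G1 U ∘ₗ 𝔬.Dstar U)
      (fun a b => BX * Real.exp (-(δ₃ * g.dist a b))) := by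
    have h := hasMaj_toR_src hG hXH
    simp only [Nat.cast_zero, neg_zero] at h
    exact h
  have hB : HasMaj (cNormR R₀ H₀ 𝔬.blkY hG.lenle 0) bout
      ((E ∘ₗ (𝔬.Dv U ∘ₗ Gp U ∘ₗ 𝔬.R U ∘ₗ 𝔬.Dvstar U)) ∘ₗ (𝔬.G1 U ∘ₗ 𝔬.Dstar U))
      (fun y y' => bXH.κ * BWE * BX * c * Real.exp (-(ρ' * g.dist y y'))) :=
    hasMaj_comp_exp htri hG.dnn hrow hBWE hBX hρ' hρ'₃ (by linarith) hWE hXH'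
  -- (d) TERM C = (E G₁Q*)((QG₁Q*)⁻¹QG₁∇*) through Y⁰ → Z¹ → Z_{len·wZ}
  have hq1' : HasMaj (cNormR R₀ H₀ 𝔬.blk hG.lenle (-1)) (cNormR R₀ H₀ 𝔬.blkZ hG.lenle (-1)) (𝔬.Q U)
      (fun a b => B₃ * Real.exp (-(δ₃ * g.dist a b))) := by
    have h := hasMaj_toR hG hq1
    simp only [Nat.cast_one] at h
    exact h
  have hQG : HasMaj (cNormR R₀ H₀ 𝔬.blkY hG.lenle 0) (cNormR R₀ H₀ 𝔬.blkZ hG.lenle (-1)) (𝔬.Q U ∘ₗ (𝔬.G1 U ∘ₗ 𝔬.Dstar U))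
      (fun a b => (cNormR R₀ H₀ 𝔬.blk hG.lenle (-1) (X := X)).κ * B₃ * (B₀ * (1 - θ * c)⁻¹) * c *
        Real.exp (-((ρ' + 2 * σ) * g.dist a b))) :=
    hasMaj_comp_exp htri hG.dnn hrow hB₃ hA₁ (by linarith) (by linarith) (by linarith) hq1' hG1
  simp only [cNormR_κ, one_mul] at hQG
  have hK₁ : 0 ≤ B₃ * (B₀ * (1 - θ * c)⁻¹) * c := mul_nonneg (mul_nonneg hB₃ hA₁) hc
  have hc11' : HasMaj (cNormR R₀ H₀ 𝔬.blkZ hG.lenle (-1)) (weightNorm (BlockNorm.ofBlocks (toB6 g R₀ H₀) 𝔬.blkZ) (fun y => g.len y * wZ y) fun y => (wZlen_pos hG hwZ y).le)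
      (𝔬.C1 U) (fun a b => B₃ * Real.exp (-(δ₃ * g.dist a b))) := by
    have h := hasMaj_toR_src hG hc1_1
    simp only [Nat.cast_one] at h
    exact h
  have hCQG : HasMaj (cNormR R₀ H₀ 𝔬.blkY hG.lenle 0) (weightNorm (BlockNorm.ofBlocks (toB6 g R₀ H₀) 𝔬.blkZ) (fun y => g.len y * wZ y) fun y => (wZlen_pos hG hwZ y).le)
      (𝔬.C1 U ∘ₗ (𝔬.Q U ∘ₗ (𝔬.G1 U ∘ₗ 𝔬.Dstar U)))
      (fun a b => (cNormR R₀ H₀ 𝔬.blkZ hG.lenle (-1) (X := Z)).κ * B₃ * (B₃ * (B₀ * (1 - θ * c)⁻¹) * c) * c *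
        Real.exp (-((ρ' + σ) * g.dist a b))) :=
    hasMaj_comp_exp htri hG.dnn hrow hB₃ hK₁ (by linarith) (by linarith) (by linarith) hc11' hQG
  simp only [cNormR_κ, one_mul] at hCQG
  have hD1Q : HasMaj (weightNorm (BlockNorm.ofBlocks (toB6 g R₀ H₀) 𝔬.blkZ) (fun y => g.len y * wZ y) fun y => (wZlen_pos hG hwZ y).le) bout
      (E ∘ₗ 𝔬.G1 U ∘ₗ 𝔬.Qstar U) (fun y y' => (Bx + θH * (B₃ * (1 - θ * c)⁻¹) * c) * Real.exp (-((ρ' + σ) * g.dist y y'))) :=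
    hasMaj_left_rightR hG hrow hθH hBx hA₃ (by linarith) (by linarith) (by linarith) (by linarith) hKE hpQs hGQ hfix1
  have hBx' : 0 ≤ Bx + θH * (B₃ * (1 - θ * c)⁻¹) * c := add_nonneg hBx (mul_nonneg (mul_nonneg hθH hA₃) hc)
  have hK₂ : 0 ≤ B₃ * (B₃ * (B₀ * (1 - θ * c)⁻¹) * c) * c := mul_nonneg (mul_nonneg hB₃ hK₁) hc
  have hC : HasMaj (cNormR R₀ H₀ 𝔬.blkY hG.lenle 0) bout
      ((E ∘ₗ 𝔬.G1 U ∘ₗ 𝔬.Qstar U) ∘ₗ (𝔬.C1 U ∘ₗ (𝔬.Q U ∘ₗ (𝔬.G1 U ∘ₗ 𝔬.Dstar U))))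
      (fun y y' => (weightNorm (BlockNorm.ofBlocks (toB6 g R₀ H₀) 𝔬.blkZ) (fun y => g.len y * wZ y) fun y => (wZlen_pos hG hwZ y).le).κ *
        (Bx + θH * (B₃ * (1 - θ * c)⁻¹) * c) *
        (B₃ * (B₃ * (B₀ * (1 - θ * c)⁻¹) * c) * c) * c * Real.exp (-(ρ' * g.dist y y'))) :=
    hasMaj_comp_exp htri hG.dnn hrow hBx' hK₂ hρ' (by linarith) le_rfl hD1Q hCQG
  simp only [weightNorm_ofBlocks_κ, one_mul] at hC
  -- (e) assembling (3.153) with E on the left and ∇* on the right, term B by (3.152)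
  have h := ((hD1.of_rate_le hG.dnn hCL (by linarith : ρ' ≤ ρ)).sub hB).sub hC
  rw [← E_GG_F_eq_3152 hI h152 E (𝔬.Dstar U)] at h
  have hC0 : 0 ≤ (Bh + θH * (B₀ * (1 - θ * c)⁻¹) * c) + bXH.κ * BWE * BX * c +
      (Bx + θH * (B₃ * (1 - θ * c)⁻¹) * c) * (B₃ * (B₃ * (B₀ * (1 - θ * c)⁻¹) * c) * c) * c :=
    add_nonneg (add_nonneg hCL (mul_nonneg (mul_nonneg (mul_nonneg bXH.κ_nonneg hBWE) hBX) hc)) (mul_nonneg (mul_nonneg hBx' hK₂) hc)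
  have h2 : HasMaj (cNormR R₀ H₀ 𝔬.blkY hG.lenle 0) bout (E ∘ₗ (𝔬.GG U ∘ₗ 𝔬.Dstar U))
      (fun a b => ((Bh + θH * (B₀ * (1 - θ * c)⁻¹) * c) + bXH.κ * BWE * BX * c +
          (Bx + θH * (B₃ * (1 - θ * c)⁻¹) * c) * (B₃ * (B₃ * (B₀ * (1 - θ * c)⁻¹) * c) * c) * c) *
        Real.exp (-(ρ' * g.dist a b))) :=
    h.mono fun a b => le_of_eq (by simp only [toB6_dist]; ring)
  have h' := hasMajorantHom_of_hasMaj_cNormR hG (fun a b => mul_nonneg hC0 (Real.exp_nonneg _)) h2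
  have h'' : HasMajorantHom (g := toB6 g R₀ H₀) 𝔬.blkY 𝔭.blkPX (𝔭.ΦX U β ∘ₗ (𝔬.GG U ∘ₗ 𝔬.Dstar U))
      (fun (a b : g.Site) => ((Bh + θH * (B₀ * (1 - θ * c)⁻¹) * c) + bXH.κ * BWE * BX * c +
          (Bx + θH * (B₃ * (1 - θ * c)⁻¹) * c) * (B₃ * (B₃ * (B₀ * (1 - θ * c)⁻¹) * c) * c) * c) *
        Real.exp (-(ρ' * g.dist a b)) * g.len a ^ (-(β - 1)) * g.len b ^ (0 : ℝ)) := h'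
  refine hasMajorantHom_mono (g := toB6 g R₀ H₀) 𝔬.blkY 𝔭.blkPX h'' fun a b => le_of_eq ?_
  simp only [Real.rpow_zero, mul_one, show -(β - 1) = 1 - β by ring]
  ring

end OneMember

end

end Literature.MathematicalPhysics.QuantumFieldTheory.Balaban1983to89.B9Thm313WholeProbe43RHolderCut
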